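import Literature.Analysis.OperatorTheory.SlabFibreContraction
import HarnessLib

/-!
# `ThermalDescent.HsTransfer` / `PeriodDescent` (stmt-QuantumFields-26517, stub `stub_hsTransfer` via `stub_slabChain`):
# the contracted kernel of a time-reversed block is the transposed kernel

Generic slab-toolkit lemma (Fubini–Tonelli bookkeeping, Mathlib only): in the currency of
`Literature/Analysis/OperatorTheory/SlabFibreContraction.lean` (slices `X`, fibres `Γ`, slab weight `c(x, γ, x')`, block functions
`α(W, γ⃗)` of `r + 2` slices and `r + 1` fibres, contracted block kernel `X_α(u,u') = ∫∫ α(u ∷ v :: u', γ⃗) ∏ᵢ c(…) dν dμ`): if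
`β(W, γ⃗) = α(W ∘ rev, ι ∘ γ⃗ ∘ rev)` for a measure-preserving involution `ι` of the fibre with `c(a, ι g, b) = c(b, g, a)` (for the
Wilson slab weight: inversion of the temporal links, `finTorusTemporalAction_swap_inv`), then `X_β(u, u') = X_α(u', u)` — the
time-reflected insertion of the reflection-positivity form is the TRANSPOSED kernel, as `stub_slabChain` requires.  [folklore]
-/

set_option autoImplicit false

noncomputable section

open MeasureTheory Filter

namespace Summit.QuantumFields.YangMills.Theorems.ThermalDescentSlabChain

/-- The reversed block: `(cons u (snoc v u')) ∘ rev = cons u' (snoc (v ∘ rev) u)`. [folklore] -/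
theorem cons_snoc_comp_rev {X : Type*} {r : ℕ} (u u' : X) (v : Fin r → X) :
    (fun j : Fin (r + 2) => (Fin.cons u (Fin.snoc v u') : Fin (r + 2) → X) (Fin.rev j)) =
      (Fin.cons u' (Fin.snoc (fun k : Fin r => v (Fin.rev k)) u) : Fin (r + 2) → X) := by
  funext j
  rw [Fin.cons_rev, Fin.snoc_comp_rev]
  exact (congrFun (Fin.cons_snoc_eq_snoc_cons u' (fun k : Fin r => v (Fin.rev k)) u) j).symm

/-- **The contracted kernel of a time-reversed block function is the transpose.**  If `β(W, γ) = α(W ∘ rev, ι ∘ γ ∘ rev)`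
for a measure-preserving involution `ι` of the fibre and the slab weight satisfies `c(a, ι g, b) = c(b, g, a)`, then
`X_β(u, u') = X_α(u', u)` (change of variables `v ↦ v ∘ rev`, `γ ↦ ι ∘ γ ∘ rev` in the block integral). [folklore] -/
theorem blockKernel_transpose {X Γ : Type*} [MeasurableSpace X] [MeasurableSpace Γ] (μ : Measure X) (ν : Measure Γ)
    [SigmaFinite μ] [SigmaFinite ν] (ι : Γ ≃ᵐ Γ) (hι : MeasurePreserving ι ν ν) (hιι : ∀ g, ι (ι g) = g)
    {r : ℕ} (c : X → Γ → X → ℝ) (hc : ∀ a g b, c a (ι g) b = c b g a)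
    (α β : (Fin (r + 2) → X) → (Fin (r + 1) → Γ) → ℝ)
    (hαβ : ∀ W γ, β W γ = α (fun j => W (Fin.rev j)) (fun i => ι (γ (Fin.rev i)))) (u u' : X) :
    (∫ v : Fin r → X, ∫ γs : Fin (r + 1) → Γ, β (Fin.cons u (Fin.snoc v u')) γs * ∏ i : Fin (r + 1),
        c ((Fin.cons u (Fin.snoc v u') : Fin (r + 2) → X) (Fin.castSucc i)) (γs i)
          ((Fin.cons u (Fin.snoc v u') : Fin (r + 2) → X) (Fin.succ i)) ∂(Measure.pi fun _ => ν)
        ∂(Measure.pi fun _ => μ)) =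
      ∫ v : Fin r → X, ∫ γs : Fin (r + 1) → Γ, α (Fin.cons u' (Fin.snoc v u)) γs * ∏ i : Fin (r + 1),
        c ((Fin.cons u' (Fin.snoc v u) : Fin (r + 2) → X) (Fin.castSucc i)) (γs i)
          ((Fin.cons u' (Fin.snoc v u) : Fin (r + 2) → X) (Fin.succ i)) ∂(Measure.pi fun _ => ν)
        ∂(Measure.pi fun _ => μ) := by
  -- the two measure-preserving reversals
  set eX : (Fin r → X) ≃ᵐ (Fin r → X) := MeasurableEquiv.piCongrLeft (fun _ : Fin r => X) Fin.revPerm with heX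
  have hX : MeasurePreserving eX (Measure.pi fun _ : Fin r => μ) (Measure.pi fun _ : Fin r => μ) :=
    measurePreserving_piCongrLeft (fun _ : Fin r => μ) Fin.revPerm
  have heXa : ∀ v : Fin r → X, eX v = fun k => v (Fin.rev k) := fun v => by
    funext k
    simp only [heX, MeasurableEquiv.coe_piCongrLeft, Equiv.piCongrLeft_apply_eq_cast, cast_eq, Fin.revPerm_symm,
      Fin.revPerm_apply]
  set eΓ : (Fin (r + 1) → Γ) ≃ᵐ (Fin (r + 1) → Γ) :=
    (MeasurableEquiv.piCongrLeft (fun _ : Fin (r + 1) => Γ) Fin.revPerm).trans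
      (MeasurableEquiv.piCongrRight fun _ : Fin (r + 1) => ι) with heΓ
  have heΓa : ∀ γ : Fin (r + 1) → Γ, eΓ γ = fun i => ι (γ (Fin.rev i)) := fun γ => by
    funext i
    simp only [heΓ, MeasurableEquiv.trans_apply, MeasurableEquiv.piCongrRight, MeasurableEquiv.coe_mk,
      Equiv.piCongrRight_apply, MeasurableEquiv.coe_toEquiv, Pi.map_apply]
    rw [MeasurableEquiv.coe_piCongrLeft, Equiv.piCongrLeft_apply_eq_cast, cast_eq, Fin.revPerm_symm, Fin.revPerm_apply]
  have hΓ : MeasurePreserving eΓ (Measure.pi fun _ : Fin (r + 1) => ν) (Measure.pi fun _ : Fin (r + 1) => ν) := by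
    have h1 : MeasurePreserving (MeasurableEquiv.piCongrLeft (fun _ : Fin (r + 1) => Γ) Fin.revPerm)
        (Measure.pi fun _ : Fin (r + 1) => ν) (Measure.pi fun _ : Fin (r + 1) => ν) :=
      measurePreserving_piCongrLeft (fun _ : Fin (r + 1) => ν) Fin.revPerm
    have h2 : MeasurePreserving (MeasurableEquiv.piCongrRight fun _ : Fin (r + 1) => ι)
        (Measure.pi fun _ : Fin (r + 1) => ν) (Measure.pi fun _ : Fin (r + 1) => ν) :=
      measurePreserving_pi _ _ fun _ => hι
    exact h2.comp h1
  -- substitute in the outer and inner integrals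
  rw [← hX.integral_comp']
  refine integral_congr_ae (Eventually.of_forall fun v => ?_)
  dsimp only
  rw [heXa, ← hΓ.integral_comp']
  refine integral_congr_ae (Eventually.of_forall fun γ => ?_)
  dsimp only
  rw [heΓa, hαβ]
  -- the block read backwards
  have hW : (fun j : Fin (r + 2) => (Fin.cons u (Fin.snoc (fun k : Fin r => v (Fin.rev k)) u') : Fin (r + 2) → X)
      (Fin.rev j)) = (Fin.cons u' (Fin.snoc v u) : Fin (r + 2) → X) := by
    rw [cons_snoc_comp_rev]
    simp only [Fin.rev_rev]
  have hγ : (fun i : Fin (r + 1) => ι ((fun i => ι (γ (Fin.rev i))) (Fin.rev i))) = γ := by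
    funext i; simp only [Fin.rev_rev, hιι]
  rw [hW, hγ]
  congr 1
  -- the weight: reverse the product and use the symmetry of `c`
  have hWj : ∀ j : Fin (r + 2), (Fin.cons u (Fin.snoc (fun k : Fin r => v (Fin.rev k)) u') : Fin (r + 2) → X) j =
      (Fin.cons u' (Fin.snoc v u) : Fin (r + 2) → X) (Fin.rev j) := fun j => by
    have := congrFun hW (Fin.rev j)
    simpa only [Fin.rev_rev] using this
  calc ∏ i : Fin (r + 1), c ((Fin.cons u (Fin.snoc (fun k : Fin r => v (Fin.rev k)) u') : Fin (r + 2) → X) i.castSucc)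
        ((fun i => ι (γ (Fin.rev i))) i)
        ((Fin.cons u (Fin.snoc (fun k : Fin r => v (Fin.rev k)) u') : Fin (r + 2) → X) i.succ)
      = ∏ i : Fin (r + 1), c ((Fin.cons u' (Fin.snoc v u) : Fin (r + 2) → X) (Fin.rev i).castSucc) (γ (Fin.rev i))
          ((Fin.cons u' (Fin.snoc v u) : Fin (r + 2) → X) (Fin.rev i).succ) := by
        refine Finset.prod_congr rfl fun i _ => ?_
        rw [hWj, hWj, Fin.rev_castSucc, Fin.rev_succ, hc]
    _ = ∏ i : Fin (r + 1), c ((Fin.cons u' (Fin.snoc v u) : Fin (r + 2) → X) i.castSucc) (γ i)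
          ((Fin.cons u' (Fin.snoc v u) : Fin (r + 2) → X) i.succ) :=
        Fintype.prod_equiv Fin.revPerm _ _ fun i => by simp only [Fin.revPerm_apply]

end Summit.QuantumFields.YangMills.Theorems.ThermalDescentSlabChain

end
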